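/-
Copyright (c) 2026 the pub-hodgecm-mathlib formalisation cell (harness21).  Prover seat hodgecm-mathlib-K2Liu-p11 (g0), Track B «K2-LIT»,
#184♮ = hLiu418 = `stmt-HodgeConjecture-24832`; LEAD F0P6-plan (g12) DEAL 2026-09-04T07:52:11Z ∕ 07:54:09Z «(α) ADELIC→ARCH GLUE»,
SIGS-RoadI-v3 §Hol rows H1-E ∕ Hol-2b, file G-2 (adelic layer).  THEOREMS ONLY (no `def`, no `instance`, no notation, no named-fact
hypothesis, no `sorry`).
-/
import Summits.HodgeConjecture.HodgeConjecture.Theorems.K2LiuHolDescendFrame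
import Summits.HodgeConjecture.HodgeConjecture.Theorems.K2LiuArchSkewPlaces
import Summits.HodgeConjecture.HodgeConjecture.Theorems.K2LiuHolTubeRigidityOfFrame
import Summits.HodgeConjecture.HodgeConjecture.Theorems.K2LiuArchOneParameterOrbitDefs
import Summits.HodgeConjecture.HodgeConjecture.Theorems.K2LiuWeakApproximationOfHodgeCM
import HarnessLib

/-!
# Crux `HLiu418`, Road I: the ADELIC → ARCH glue — holomorphic descent of an adelic form through the H1-C frame

Cell `hodgecm-mathlib`, crux item hLiu418 = `stmt-HodgeConjecture-24832` (helper lane `--supports`, count-neutral).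

Setting and letters of ★ `K2LiuHolTubeRigidityOfFrame` §2 (K2Liu-p10 (g2)), VERBATIM: the CM field `L`, the doubled skew-hermitian space
`hermD L e dV hdV dW hdW` (`n + n` variables), `A = H_∞ = UnitaryGroup.arch (Fp L) L c̄ (n+n) hermD`, the complex places `σ`, frames
`T Tinv : σ → M_{2n}(ℂ)` with the clauses of ★ `exists_tubeFrame_arch₂` as hypotheses, and the frame map
`Fr a w = T w · (archAt w a)~ · Tinv w`.  For an adelic function `F̂ : HA → ℂ` we PRODUCE the descent data that Hol-2b consumes:
`∃ Φ f, (∀ x a, Φ x (Fr a) = F̂ (a_∞ · x_f)) ∧ hE0 ∧ hhol` (the binders of ★ `eq_zero_of_hol_of_frame`), from three BY-VALUE inputs: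
 (T)  the scalar `K∞`-type of `F̂` under right translation by `u ∈ H_∞` framed into `Stab(i·1)^σ`;
 (L)  the G1 clause: a family `DF̂ X : HA → ℂ` (`X ∈ 𝔲 = archSkew`), continuous, linear in `X`, with
      `HasDerivAt (t ↦ F̂ (h · archExp hX t)) (DF̂ X (h · archExp hX t)) t` — the output form of ★ `hasDerivAt_resNorm_orbit`;
 (CR) `DF̂ X(w, μ b) = i · DF̂ X(w, σ b)` for the archSkew letters `X(w, Y)` framed to the tube letters `μ b − iσ b ∈ 𝔭⁻` at `w`
      (★ `K2LiuHermitianTubeFramePMinus.mu_sub_I_smul_sigma_eq`).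
§1 `Fr` injective and topology-inducing; §2 the archSkew letters `X(w,Y)` (`w`-coordinate `(Tinv w · Y · T w)~`, zero elsewhere) and
`Fr (expGL (t X(w,Y))) = update 1 w (exp (tY))`; §3 `exists_holDescend_adelic` on ★ `K2LiuHolDescendFrame.exists_holDescend_of_frame`.
References: [Shimura1997, §§5–6]; [BorelJacquet1979, §4.1]; [Bump1997, §2.1].
HONEST LABEL: HC_CM is proved only modulo the 7 printed citations (2 remaining named inputs: hLiu418 = stmt-HodgeConjecture-24832,
h413 = stmt-HodgeConjecture-24833) until rung 0 closes; count-neutral helper, closes no socket.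
-/

set_option autoImplicit false
set_option linter.dupNamespace false

noncomputable section

open scoped Classical Matrix Topology MatrixGroups
open NumberField NumberField.mixedEmbedding NumberField.InfinitePlace IsDedekindDomain Filter Set NormedSpace
open Literature.NumberTheory.ModularForms.SiegelUpperHalfSpace (num denom moeb)
open Literature.AlgebraicGeometry.ShimuraVarieties.KudlaRapoport2013.Sec11Sec12MainTheorem (hermUpperHalfSpace)
open Literature.NumberTheory.Automorphic Literature.NumberTheory.Automorphic.UnitaryGroup
open Literature.NumberTheory.GelbartRogawski1991 Literature.NumberTheory.GelbartRogawski1991.GRConstruction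
open Literature.NumberTheory.K2Lit.SiegelDoubled
open Summit.HodgeConjecture.HodgeConjecture.Cruxes.HLiu418.K2LiuArchOneParameterOrbitDefs
open Summit.HodgeConjecture.HodgeConjecture.Cruxes.HLiu418.K2LiuLieRayDifferentiability (conjTranspose_exp_mul_J_mul_exp)
open Summit.HodgeConjecture.HodgeConjecture.Cruxes.HLiu418.K2LiuArchSkewPlaces
open Summit.HodgeConjecture.HodgeConjecture.Cruxes.HLiu418.K2LiuHolTubeRigidityOfFrame
open Summit.HodgeConjecture.HodgeConjecture.Cruxes.HLiu418.K2LiuHolDescendFrame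

namespace Summit.HodgeConjecture.HodgeConjecture.Cruxes.HLiu418.K2LiuHolDescendAdelic

variable (L : Type) [Field L] [NumberField L] [IsCMField L] {N M n : ℕ} (e : Fin N × Fin M ≃ Fin n)
  (dV : Fin N → L) (hdV : ∀ i, IsCMField.complexConj L (dV i) = dV i)
  (dW : Fin M → L) (hdW : ∀ i, IsCMField.complexConj L (dW i) = dW i)
  (T Tinv : {w : InfinitePlace L // w.IsComplex} → Matrix (Fin n ⊕ Fin n) (Fin n ⊕ Fin n) ℂ)
  (Fr : UnitaryGroup.arch (Fp L) L (IsCMField.complexConj L) (n + n) (hermD L e dV hdV dW hdW) →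
    {w : InfinitePlace L // w.IsComplex} → Matrix (Fin n ⊕ Fin n) (Fin n ⊕ Fin n) ℂ)
  (hFr : ∀ a w, Fr a w = T w * Matrix.reindex (e₂ (n := n)).symm (e₂ (n := n)).symm
    (((UnitaryGroup.archAt (Fp L) L (IsCMField.complexConj L) (n + n) (hermD L e dV hdV dW hdW) w
      (UnitaryGroup.complexConj_smul_infinitePlace L w.1) (IsCMField.complexConj_ne_one L) a :
        UnitaryGroup.archLocal L (n + n) (hermD L e dV hdV dW hdW) w) : GL (Fin (n + n)) ℂ) : Matrix (Fin (n + n)) (Fin (n + n)) ℂ) * Tinv w)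
  (hT1 : ∀ w, T w * Tinv w = 1) (hT2 : ∀ w, Tinv w * T w = 1)
  (hTU : ∀ w (g : GL (Fin (n + n)) ℂ), g ∈ UnitaryGroup.archLocal L (n + n) (hermD L e dV hdV dW hdW) w →
    (T w * Matrix.reindex (e₂ (n := n)).symm (e₂ (n := n)).symm (g : Matrix _ _ ℂ) * Tinv w)ᴴ * Matrix.J (Fin n) ℂ *
      (T w * Matrix.reindex (e₂ (n := n)).symm (e₂ (n := n)).symm (g : Matrix _ _ ℂ) * Tinv w) = Matrix.J (Fin n) ℂ)
  (hTS : ∀ w (P : Matrix (Fin n ⊕ Fin n) (Fin n ⊕ Fin n) ℂ), Pᴴ * Matrix.J (Fin n) ℂ * P = Matrix.J (Fin n) ℂ →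
    ∃ g : GL (Fin (n + n)) ℂ, g ∈ UnitaryGroup.archLocal L (n + n) (hermD L e dV hdV dW hdW) w ∧
      T w * Matrix.reindex (e₂ (n := n)).symm (e₂ (n := n)).symm (g : Matrix _ _ ℂ) * Tinv w = P)

/-! ## §1 The frame map is injective and topology-inducing -/

include hFr in
/-- `Fr a w` written through the matrix of `a`: `T w · (a_w)~ · Tinv w` with `a_w = (↑a).map (evalC L w)`. [cite: BorelJacquet1979, §4.1] -/
theorem frame_eq_map (a : UnitaryGroup.arch (Fp L) L (IsCMField.complexConj L) (n + n) (hermD L e dV hdV dW hdW))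
    (w : {w : InfinitePlace L // w.IsComplex}) :
    Fr a w = T w * Matrix.reindex (e₂ (n := n)).symm (e₂ (n := n)).symm
      ((((a : GL (Fin (n + n)) (mixedSpace L)) : Matrix (Fin (n + n)) (Fin (n + n)) (mixedSpace L))).map (evalC L w)) * Tinv w := by
  rw [hFr]
  rfl

include hFr hT2 in
/-- **`Fr` is injective** (frame injectivity at each place + ★ `archPiEquiv`). [cite: BorelJacquet1979, §4.1] -/
theorem frame_injective : Function.Injective Fr := by
  intro a b h
  apply (UnitaryGroup.archPiEquiv (Fp L) L (IsCMField.complexConj L) (n + n) (hermD L e dV hdV dW hdW) (IsCMField.complexConj_ne_one L)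
    (UnitaryGroup.complexConj_smul_infinitePlace L)).injective
  funext w
  have hw := congrFun h w
  rw [hFr, hFr] at hw
  have h1 := (Matrix.reindex (e₂ (n := n)).symm (e₂ (n := n)).symm).injective (eq_of_frame_conj_eq L T Tinv (hT2 w) hw)
  rw [UnitaryGroup.archPiEquiv_apply, UnitaryGroup.archPiEquiv_apply]
  exact Subtype.ext (Units.ext h1)

include hFr hT2 in
/-- **`Fr` induces the topology of `H_∞`** (★ `isInducing_coe_arch` for the invertible form `hermD`, and an explicit continuous left inverse of
`M ↦ (T w · M_w~ · Tinv w)_w`). [cite: BorelJacquet1979, §4.1] -/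
theorem frame_isInducing (hdV0 : ∀ i, dV i ≠ 0) (hdW0 : ∀ j, dW j ≠ 0) : Topology.IsInducing Fr := by
  -- `Fr = Ψ ∘ (matrix of ·)`
  set Ψ : Matrix (Fin (n + n)) (Fin (n + n)) (mixedSpace L) → {w : InfinitePlace L // w.IsComplex} →
      Matrix (Fin n ⊕ Fin n) (Fin n ⊕ Fin n) ℂ :=
    fun Mx w => T w * Matrix.reindex (e₂ (n := n)).symm (e₂ (n := n)).symm (Mx.map (evalC L w)) * Tinv w with hΨ
  have hFrΨ : Fr = Ψ ∘ fun a : UnitaryGroup.arch (Fp L) L (IsCMField.complexConj L) (n + n) (hermD L e dV hdV dW hdW) =>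
      (((a : GL (Fin (n + n)) (mixedSpace L)) : Matrix (Fin (n + n)) (Fin (n + n)) (mixedSpace L))) := by
    funext a w
    exact frame_eq_map L e dV hdV dW hdW T Tinv Fr hFr a w
  -- a continuous left inverse of `Ψ`
  set Λ' : ({w : InfinitePlace L // w.IsComplex} → Matrix (Fin n ⊕ Fin n) (Fin n ⊕ Fin n) ℂ) →
      Matrix (Fin (n + n)) (Fin (n + n)) (mixedSpace L) :=
    fun P => Matrix.of fun i j => ((0 : {w : InfinitePlace L // w.IsReal} → ℝ),
      fun w => (Matrix.reindex (e₂ (n := n)) (e₂ (n := n)) (Tinv w * P w * T w)) i j) with hΛ'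
  have hΛΨ : Λ' ∘ Ψ = id := by
    funext Mx
    refine eq_of_forall_map_evalC_eq (Fp L) L (IsCMField.complexConj L) (n + n) (IsCMField.complexConj_ne_one L)
      (UnitaryGroup.complexConj_smul_infinitePlace L) fun w => ?_
    ext i j
    simp only [Function.comp_apply, hΛ', hΨ, Matrix.map_apply, Matrix.of_apply, evalC_apply, id]
    rw [show Tinv w * (T w * Matrix.reindex (e₂ (n := n)).symm (e₂ (n := n)).symm (Mx.map (evalC L w)) * Tinv w) * T w =
        (Tinv w * T w) * Matrix.reindex (e₂ (n := n)).symm (e₂ (n := n)).symm (Mx.map (evalC L w)) * (Tinv w * T w) by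
          simp only [Matrix.mul_assoc], hT2, Matrix.one_mul, Matrix.mul_one, Matrix.reindex_apply, Matrix.reindex_apply,
      Matrix.submatrix_submatrix, Equiv.symm_symm, Equiv.self_comp_symm, Matrix.submatrix_id_id, Matrix.map_apply, evalC_apply]
  have hΨc : Continuous Ψ := by
    refine continuous_pi fun w => ?_
    exact (continuous_const.matrix_mul (((continuous_id.matrix_map (continuous_evalC L w)).matrix_submatrix _ _))).matrix_mul
      continuous_const
  have hΛc : Continuous Λ' := by
    refine continuous_matrix fun i j => continuous_const.prodMk (continuous_pi fun w => ?_)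
    have hc : Continuous fun P : {w : InfinitePlace L // w.IsComplex} → Matrix (Fin n ⊕ Fin n) (Fin n ⊕ Fin n) ℂ =>
        Matrix.reindex (e₂ (n := n)) (e₂ (n := n)) (Tinv w * P w * T w) := by
      simp only [Matrix.reindex_apply]
      exact ((continuous_const.matrix_mul (continuous_apply w)).matrix_mul continuous_const).matrix_submatrix _ _
    exact (continuous_apply_apply i j).comp hc
  have hΨind : Topology.IsInducing Ψ :=
    Topology.IsInducing.of_comp hΨc hΛc (by rw [hΛΨ]; exact Topology.IsInducing.id)
  -- the matrix map is inducing on `U(hermD)(L ⊗ ℝ)` (invertible form)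
  have hJ : IsUnit (archFormOf L (n + n) (hermD L e dV hdV dW hdW)).det := by
    rw [archFormOf, ← RingHom.mapMatrix_apply, ← RingHom.map_det]
    exact (K2LiuWeakApproximationOfHodgeCM.isUnit_det_hermD L e dV hdV hdV0 dW hdW hdW0).map _
  rw [hFrΨ]
  exact hΨind.comp (isInducing_coe_arch (Fp L) L (IsCMField.complexConj L) (n + n) (hermD L e dV hdV dW hdW) hJ)

/-! ## §2 One-parameter subgroups framed to the tube letters -/

set_option backward.isDefEq.respectTransparency false in
omit [NumberField L] [IsCMField L] in
/-- `exp` commutes with reindexing (★ `NormedSpace.map_exp` along `Matrix.reindexAlgEquiv`). [cite: Knapp2002, Introduction §2] -/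
theorem exp_reindex {m m' : Type*} [Fintype m] [Fintype m'] [DecidableEq m] [DecidableEq m'] (eq : m ≃ m') (Mx : Matrix m m ℂ) :
    exp (Matrix.reindex eq eq Mx) = Matrix.reindex eq eq (exp Mx) := by
  open scoped Matrix.Norms.Operator in
  have h := NormedSpace.map_exp (Matrix.reindexAlgEquiv ℝ ℂ eq) (continuous_id.matrix_submatrix _ _) Mx
  rw [Matrix.coe_reindexAlgEquiv] at h
  exact h.symm

omit [NumberField L] [IsCMField L] in
/-- Reindexing is `ℝ`-linear. [folklore] -/
theorem reindex_real_smul {m m' : Type*} (eq : m ≃ m') (t : ℝ) (Mx : Matrix m m ℂ) :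
    Matrix.reindex eq eq (t • Mx) = t • Matrix.reindex eq eq Mx := by
  ext i j
  rfl

include hT1 hT2 in
omit [NumberField L] [IsCMField L] in
/-- `exp (t (Tinv·Y·T)~) = (Tinv · exp (tY) · T)~`. [cite: Knapp2002, Introduction §2] -/
theorem exp_smul_frameConj (w : {w : InfinitePlace L // w.IsComplex}) (Y : Matrix (Fin n ⊕ Fin n) (Fin n ⊕ Fin n) ℂ) (t : ℝ) :
    exp (t • Matrix.reindex (e₂ (n := n)) (e₂ (n := n)) (Tinv w * Y * T w)) =
      Matrix.reindex (e₂ (n := n)) (e₂ (n := n)) (Tinv w * exp (t • Y) * T w) := by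
  set U : (Matrix (Fin n ⊕ Fin n) (Fin n ⊕ Fin n) ℂ)ˣ := ⟨Tinv w, T w, hT2 w, hT1 w⟩ with hU
  have hconj : exp (t • (Tinv w * Y * T w)) = Tinv w * exp (t • Y) * T w := by
    have h := Matrix.exp_units_conj U (t • Y)
    have hl : (U : Matrix (Fin n ⊕ Fin n) (Fin n ⊕ Fin n) ℂ) * (t • Y) * (U⁻¹ : (Matrix (Fin n ⊕ Fin n) (Fin n ⊕ Fin n) ℂ)ˣ) =
        t • (Tinv w * Y * T w) := by
      show Tinv w * (t • Y) * T w = _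
      rw [Matrix.mul_smul, Matrix.smul_mul]
    rw [hl] at h
    exact h
  rw [← reindex_real_smul, exp_reindex, hconj]

include hT1 hT2 hTS in
/-- **The archSkew letter of a tube letter at a place**: for `Y ∈ 𝔲(J)` and a complex place `w` there is `X ∈ 𝔲 = archSkew` with
`w`-coordinate `(Tinv w · Y · T w)~` and all other coordinates `0`. [cite: BorelJacquet1979, §4.1] -/
theorem exists_archSkew_letter (w : {w : InfinitePlace L // w.IsComplex}) (Y : Matrix (Fin n ⊕ Fin n) (Fin n ⊕ Fin n) ℂ)
    (hY : Yᴴ * Matrix.J (Fin n) ℂ + Matrix.J (Fin n) ℂ * Y = 0) :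
    ∃ X : Matrix (Fin (n + n)) (Fin (n + n)) (mixedSpace L),
      X ∈ archSkew (Fp L) L (IsCMField.complexConj L) (n + n) (hermD L e dV hdV dW hdW) ∧
      X.map (evalC L w) = Matrix.reindex (e₂ (n := n)) (e₂ (n := n)) (Tinv w * Y * T w) ∧
      ∀ w' : {w : InfinitePlace L // w.IsComplex}, w' ≠ w → X.map (evalC L w') = 0 := by
  -- the framed letter generates a one-parameter subgroup of `archLocal w`
  have hmem : ∀ t : ℝ, expGL (t • Matrix.reindex (e₂ (n := n)) (e₂ (n := n)) (Tinv w * Y * T w)) ∈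
      UnitaryGroup.archLocal L (n + n) (hermD L e dV hdV dW hdW) w := by
    intro t
    obtain ⟨g, hg, hTg⟩ := hTS w (exp (t • Y)) (conjTranspose_exp_mul_J_mul_exp hY t)
    have hcomp : T w * Matrix.reindex (e₂ (n := n)).symm (e₂ (n := n)).symm
        (Matrix.reindex (e₂ (n := n)) (e₂ (n := n)) (Tinv w * exp (t • Y) * T w)) * Tinv w = exp (t • Y) := by
      rw [Matrix.reindex_apply, Matrix.reindex_apply, Matrix.submatrix_submatrix, Equiv.symm_symm, Equiv.symm_comp_self,
        Matrix.submatrix_id_id,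
        show T w * (Tinv w * exp (t • Y) * T w) * Tinv w = (T w * Tinv w) * exp (t • Y) * (T w * Tinv w) by simp only [Matrix.mul_assoc],
        hT1, Matrix.one_mul, Matrix.mul_one]
    rw [← hcomp] at hTg
    have hgeq := (Matrix.reindex (e₂ (n := n)).symm (e₂ (n := n)).symm).injective (eq_of_frame_conj_eq L T Tinv (hT2 w) hTg)
    have hunit : expGL (t • Matrix.reindex (e₂ (n := n)) (e₂ (n := n)) (Tinv w * Y * T w)) = g := by
      apply Units.ext
      rw [coe_expGL, exp_smul_frameConj L T Tinv hT1 hT2 w Y t, ← hgeq]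
    rw [hunit]
    exact hg
  have hskew := skew_of_forall_exp_mem L (n + n) (hermD L e dV hdV dW hdW) w _ hmem
  exact exists_archSkew_single (Fp L) L (IsCMField.complexConj L) (n + n) (hermD L e dV hdV dW hdW) (IsCMField.complexConj_ne_one L)
    (UnitaryGroup.complexConj_smul_infinitePlace L) w _ hskew

include hFr hT1 hT2 in
/-- **The frame image of a one-parameter subgroup**: if `X ∈ 𝔲` has `w`-coordinate `(Tinv w · Y · T w)~` and vanishes at the other places,
then `Fr (expGL (tX)) = update 1 w (exp (tY))`. [cite: BorelJacquet1979, §4.1] -/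
theorem frame_expGL {X : Matrix (Fin (n + n)) (Fin (n + n)) (mixedSpace L)}
    (hX : X ∈ archSkew (Fp L) L (IsCMField.complexConj L) (n + n) (hermD L e dV hdV dW hdW)) (w : {w : InfinitePlace L // w.IsComplex})
    (Y : Matrix (Fin n ⊕ Fin n) (Fin n ⊕ Fin n) ℂ) (hXw : X.map (evalC L w) = Matrix.reindex (e₂ (n := n)) (e₂ (n := n)) (Tinv w * Y * T w))
    (hX0 : ∀ w' : {w : InfinitePlace L // w.IsComplex}, w' ≠ w → X.map (evalC L w') = 0) (t : ℝ) :
    Fr ⟨expGL (t • X), expGL_smul_mem_arch _ hX t⟩ =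
      Function.update (1 : {w : InfinitePlace L // w.IsComplex} → Matrix (Fin n ⊕ Fin n) (Fin n ⊕ Fin n) ℂ) w (exp (t • Y)) := by
  funext w'
  rw [frame_eq_map L e dV hdV dW hdW T Tinv Fr hFr]
  have hcoe : ((((⟨expGL (t • X), expGL_smul_mem_arch _ hX t⟩ :
      UnitaryGroup.arch (Fp L) L (IsCMField.complexConj L) (n + n) (hermD L e dV hdV dW hdW)) : GL (Fin (n + n)) (mixedSpace L)) :
        Matrix (Fin (n + n)) (Fin (n + n)) (mixedSpace L)).map (evalC L w')) = exp (t • X.map (evalC L w')) := by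
    rw [show (((⟨expGL (t • X), expGL_smul_mem_arch _ hX t⟩ :
      UnitaryGroup.arch (Fp L) L (IsCMField.complexConj L) (n + n) (hermD L e dV hdV dW hdW)) : GL (Fin (n + n)) (mixedSpace L)) :
        Matrix (Fin (n + n)) (Fin (n + n)) (mixedSpace L)) = exp (t • X) from rfl,
      map_evalC_exp, map_evalC_smul]
  rw [hcoe]
  by_cases hw : w' = w
  · subst hw
    rw [Function.update_self, hXw, exp_smul_frameConj L T Tinv hT1 hT2 w' Y t, Matrix.reindex_apply, Matrix.reindex_apply,
      Matrix.submatrix_submatrix, Equiv.symm_symm, Equiv.symm_comp_self, Matrix.submatrix_id_id,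
      show T w' * (Tinv w' * exp (t • Y) * T w') * Tinv w' = (T w' * Tinv w') * exp (t • Y) * (T w' * Tinv w') by
        simp only [Matrix.mul_assoc], hT1, Matrix.one_mul, Matrix.mul_one]
  · rw [Function.update_of_ne hw, Pi.one_apply, hX0 w' hw, smul_zero, NormedSpace.exp_zero, Matrix.reindex_apply,
      Matrix.submatrix_one_equiv, Matrix.mul_one, hT1]

/-! ## §3 The adelic holomorphic descent -/

include hFr hT1 hT2 hTU hTS in
/-- **THE ADELIC → ARCH GLUE.**  Let `F̂ : HA → ℂ` satisfy, BY VALUE: (T) the scalar `K∞`-type under right translation by `u ∈ H_∞` framed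
into `Stab(i·1)^σ`; (L) the G1 clause — a family `DF̂ X` (`X ∈ 𝔲 = archSkew`), continuous on `HA`, linear in `X`, with
`HasDerivAt (t ↦ F̂ (h · archExp hX t)) (DF̂ X (h · archExp hX t)) t` (★ `hasDerivAt_resNorm_orbit`'s output form); (CR) at every complex place
`w`, `DF̂ X(w, μ b) = i · DF̂ X(w, σ b)` for the archSkew letters framed to the tube letters `μ b, σ b` (hermitian `b`).  Then the tube-side avatar
`Φ x (Fr a) := F̂ (a · x)` descends: `∃ Φ f, hΦ ∧ hE0 ∧ hhol` — the inputs of ★ `K2LiuHolTubeRigidityOfFrame.eq_zero_of_hol_of_frame`.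
[cite: Shimura1997, §§5–6] [cite: BorelJacquet1979, §4.1] -/
theorem exists_holDescend_adelic (hdV0 : ∀ i, dV i ≠ 0) (hdW0 : ∀ j, dW j ≠ 0) (k : {w : InfinitePlace L // w.IsComplex} → ℤ)
    (F : HA L e dV hdV dW hdW → ℂ)
    (hKtype : ∀ (x : UnitaryGroup.finAdelic (Fp L) L (IsCMField.complexConj L) (n + n) (hermD L e dV hdV dW hdW))
      (a u : UnitaryGroup.arch (Fp L) L (IsCMField.complexConj L) (n + n) (hermD L e dV hdV dW hdW)),
      (∀ w, moeb (Fr u w) (Complex.I • 1) = Complex.I • 1) →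
      F ((UnitaryGroup.archToAdelic (Fp L) L (IsCMField.complexConj L) (n + n) (hermD L e dV hdV dW hdW) (a * u) *
          UnitaryGroup.finAdelicToAdelic (Fp L) L (IsCMField.complexConj L) (n + n) (hermD L e dV hdV dW hdW) x : HA L e dV hdV dW hdW)) =
        (∏ w, (denom (Fr u w) (Complex.I • (1 : Matrix (Fin n) (Fin n) ℂ))).det ^ k w)⁻¹ *
          F ((UnitaryGroup.archToAdelic (Fp L) L (IsCMField.complexConj L) (n + n) (hermD L e dV hdV dW hdW) a *
            UnitaryGroup.finAdelicToAdelic (Fp L) L (IsCMField.complexConj L) (n + n) (hermD L e dV hdV dW hdW) x : HA L e dV hdV dW hdW)))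
    (DF : Matrix (Fin (n + n)) (Fin (n + n)) (mixedSpace L) → HA L e dV hdV dW hdW → ℂ)
    (hL : ∀ (X : Matrix (Fin (n + n)) (Fin (n + n)) (mixedSpace L))
      (hX : X ∈ archSkew (Fp L) L (IsCMField.complexConj L) (n + n) (hermD L e dV hdV dW hdW)) (h : HA L e dV hdV dW hdW) (t : ℝ),
      HasDerivAt (fun t : ℝ => F (h * archExp (Fp L) L (IsCMField.complexConj L) (n + n) (hermD L e dV hdV dW hdW) hX t :
        HA L e dV hdV dW hdW))
        (DF X (h * archExp (Fp L) L (IsCMField.complexConj L) (n + n) (hermD L e dV hdV dW hdW) hX t : HA L e dV hdV dW hdW)) t)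
    (hLc : ∀ X : Matrix (Fin (n + n)) (Fin (n + n)) (mixedSpace L),
      X ∈ archSkew (Fp L) L (IsCMField.complexConj L) (n + n) (hermD L e dV hdV dW hdW) → Continuous (DF X))
    (hLl : ∀ (c : ℝ) (X X' : Matrix (Fin (n + n)) (Fin (n + n)) (mixedSpace L)),
      X ∈ archSkew (Fp L) L (IsCMField.complexConj L) (n + n) (hermD L e dV hdV dW hdW) →
      X' ∈ archSkew (Fp L) L (IsCMField.complexConj L) (n + n) (hermD L e dV hdV dW hdW) →
      ∀ h, DF (c • X + X') h = (c : ℂ) * DF X h + DF X' h)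
    (hCR : ∀ (x : UnitaryGroup.finAdelic (Fp L) L (IsCMField.complexConj L) (n + n) (hermD L e dV hdV dW hdW))
      (w : {w : InfinitePlace L // w.IsComplex}) (b : Matrix (Fin n) (Fin n) ℂ)
      (a : UnitaryGroup.arch (Fp L) L (IsCMField.complexConj L) (n + n) (hermD L e dV hdV dW hdW))
      (Xμ Xσ : Matrix (Fin (n + n)) (Fin (n + n)) (mixedSpace L)), bᴴ = b →
      Xμ ∈ archSkew (Fp L) L (IsCMField.complexConj L) (n + n) (hermD L e dV hdV dW hdW) →
      Xσ ∈ archSkew (Fp L) L (IsCMField.complexConj L) (n + n) (hermD L e dV hdV dW hdW) →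
      Xμ.map (evalC L w) = Matrix.reindex (e₂ (n := n)) (e₂ (n := n)) (Tinv w * Matrix.fromBlocks b 0 0 (-b) * T w) →
      (∀ w', w' ≠ w → Xμ.map (evalC L w') = 0) →
      Xσ.map (evalC L w) = Matrix.reindex (e₂ (n := n)) (e₂ (n := n)) (Tinv w * Matrix.fromBlocks 0 b b 0 * T w) →
      (∀ w', w' ≠ w → Xσ.map (evalC L w') = 0) →
      DF Xμ ((UnitaryGroup.archToAdelic (Fp L) L (IsCMField.complexConj L) (n + n) (hermD L e dV hdV dW hdW) a *
          UnitaryGroup.finAdelicToAdelic (Fp L) L (IsCMField.complexConj L) (n + n) (hermD L e dV hdV dW hdW) x : HA L e dV hdV dW hdW)) =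
        Complex.I * DF Xσ ((UnitaryGroup.archToAdelic (Fp L) L (IsCMField.complexConj L) (n + n) (hermD L e dV hdV dW hdW) a *
          UnitaryGroup.finAdelicToAdelic (Fp L) L (IsCMField.complexConj L) (n + n) (hermD L e dV hdV dW hdW) x : HA L e dV hdV dW hdW))) :
    ∃ (Φ : UnitaryGroup.finAdelic (Fp L) L (IsCMField.complexConj L) (n + n) (hermD L e dV hdV dW hdW) →
        ({w : InfinitePlace L // w.IsComplex} → Matrix (Fin n ⊕ Fin n) (Fin n ⊕ Fin n) ℂ) → ℂ)
      (f : UnitaryGroup.finAdelic (Fp L) L (IsCMField.complexConj L) (n + n) (hermD L e dV hdV dW hdW) →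
        ({w : InfinitePlace L // w.IsComplex} → Matrix (Fin n) (Fin n) ℂ) → ℂ),
      (∀ x a, Φ x (Fr a) = F ((UnitaryGroup.archToAdelic (Fp L) L (IsCMField.complexConj L) (n + n) (hermD L e dV hdV dW hdW) a *
          UnitaryGroup.finAdelicToAdelic (Fp L) L (IsCMField.complexConj L) (n + n) (hermD L e dV hdV dW hdW) x : HA L e dV hdV dW hdW))) ∧
      (∀ x (g : {w : InfinitePlace L // w.IsComplex} → Matrix (Fin n ⊕ Fin n) (Fin n ⊕ Fin n) ℂ),
        (∀ s, (g s)ᴴ * Matrix.J (Fin n) ℂ * g s = Matrix.J (Fin n) ℂ) →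
        f x (fun s => moeb (g s) (Complex.I • 1)) = (∏ s, (denom (g s) (Complex.I • (1 : Matrix (Fin n) (Fin n) ℂ))).det ^ k s) * Φ x g) ∧
      ∀ x, DifferentiableOn ℂ (fun z : {w : InfinitePlace L // w.IsComplex} → Fin n → Fin n → ℂ => f x fun s => Matrix.of (z s))
        {z | ∀ s, Matrix.of (z s) ∈ hermUpperHalfSpace n} := by
  -- the avatar `Φ`
  obtain ⟨Φ, hΦdef⟩ : ∃ Φ : UnitaryGroup.finAdelic (Fp L) L (IsCMField.complexConj L) (n + n) (hermD L e dV hdV dW hdW) →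
        ({w : InfinitePlace L // w.IsComplex} → Matrix (Fin n ⊕ Fin n) (Fin n ⊕ Fin n) ℂ) → ℂ,
      ∀ x g, Φ x g = if h : ∃ a, Fr a = g then
        F ((UnitaryGroup.archToAdelic (Fp L) L (IsCMField.complexConj L) (n + n) (hermD L e dV hdV dW hdW) h.choose *
          UnitaryGroup.finAdelicToAdelic (Fp L) L (IsCMField.complexConj L) (n + n) (hermD L e dV hdV dW hdW) x : HA L e dV hdV dW hdW))
        else 0 := ⟨_, fun _ _ => rfl⟩
  have hinj := frame_injective L e dV hdV dW hdW T Tinv Fr hFr hT2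
  have hΦ : ∀ x a, Φ x (Fr a) = F ((UnitaryGroup.archToAdelic (Fp L) L (IsCMField.complexConj L) (n + n) (hermD L e dV hdV dW hdW) a *
      UnitaryGroup.finAdelicToAdelic (Fp L) L (IsCMField.complexConj L) (n + n) (hermD L e dV hdV dW hdW) x : HA L e dV hdV dW hdW)) :=
    fun x a => by rw [hΦdef, dif_pos (⟨a, rfl⟩ : ∃ a', Fr a' = Fr a), hinj (⟨a, rfl⟩ : ∃ a', Fr a' = Fr a).choose_spec]
  -- the archSkew letters `X(w, Y)`
  have hletter := fun (w : {w : InfinitePlace L // w.IsComplex}) (Y : Matrix (Fin n ⊕ Fin n) (Fin n ⊕ Fin n) ℂ)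
      (hY : Yᴴ * Matrix.J (Fin n) ℂ + Matrix.J (Fin n) ℂ * Y = 0) =>
    exists_archSkew_letter L e dV hdV dW hdW T Tinv hT1 hT2 hTS w Y hY
  choose Xl hXl_mem hXl_w hXl_0 using hletter
  -- linearity of `Y ↦ X(w, Y)`
  have hXl_lin : ∀ w (c : ℝ) (Y Y' : Matrix (Fin n ⊕ Fin n) (Fin n ⊕ Fin n) ℂ)
      (hY : Yᴴ * Matrix.J (Fin n) ℂ + Matrix.J (Fin n) ℂ * Y = 0) (hY' : Y'ᴴ * Matrix.J (Fin n) ℂ + Matrix.J (Fin n) ℂ * Y' = 0)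
      (hYY : (c • Y + Y')ᴴ * Matrix.J (Fin n) ℂ + Matrix.J (Fin n) ℂ * (c • Y + Y') = 0),
      Xl w (c • Y + Y') hYY = c • Xl w Y hY + Xl w Y' hY' := by
    intro w c Y Y' hY hY' hYY
    refine eq_of_forall_map_evalC_eq (Fp L) L (IsCMField.complexConj L) (n + n) (IsCMField.complexConj_ne_one L)
      (UnitaryGroup.complexConj_smul_infinitePlace L) fun w' => ?_
    rw [map_evalC_add, map_evalC_smul]
    by_cases hw : w' = w
    · subst hw
      rw [hXl_w, hXl_w, hXl_w, ← reindex_real_smul]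
      ext i j
      simp only [Matrix.reindex_apply, Matrix.submatrix_apply, Matrix.add_apply, Matrix.mul_add, Matrix.add_mul, Matrix.mul_smul,
        Matrix.smul_mul]
    · rw [hXl_0 _ _ _ _ hw, hXl_0 _ _ _ _ hw, hXl_0 _ _ _ _ hw, smul_zero, add_zero]
  -- the one-parameter subgroups `E` and the derivative data `DF` on `H_∞`
  obtain ⟨E, hEdef⟩ : ∃ E : {w : InfinitePlace L // w.IsComplex} → Matrix (Fin n ⊕ Fin n) (Fin n ⊕ Fin n) ℂ → ℝ →
        UnitaryGroup.arch (Fp L) L (IsCMField.complexConj L) (n + n) (hermD L e dV hdV dW hdW),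
      ∀ w Y t, E w Y t = if hY : Yᴴ * Matrix.J (Fin n) ℂ + Matrix.J (Fin n) ℂ * Y = 0 then
        ⟨expGL (t • Xl w Y hY), expGL_smul_mem_arch _ (hXl_mem w Y hY) t⟩ else 1 := ⟨_, fun _ _ _ => rfl⟩
  obtain ⟨D, hDdef⟩ : ∃ D : UnitaryGroup.finAdelic (Fp L) L (IsCMField.complexConj L) (n + n) (hermD L e dV hdV dW hdW) →
        {w : InfinitePlace L // w.IsComplex} → Matrix (Fin n ⊕ Fin n) (Fin n ⊕ Fin n) ℂ →
        UnitaryGroup.arch (Fp L) L (IsCMField.complexConj L) (n + n) (hermD L e dV hdV dW hdW) → ℂ,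
      ∀ x w Y a, D x w Y a = if hY : Yᴴ * Matrix.J (Fin n) ℂ + Matrix.J (Fin n) ℂ * Y = 0 then
        DF (Xl w Y hY) ((UnitaryGroup.archToAdelic (Fp L) L (IsCMField.complexConj L) (n + n) (hermD L e dV hdV dW hdW) a *
          UnitaryGroup.finAdelicToAdelic (Fp L) L (IsCMField.complexConj L) (n + n) (hermD L e dV hdV dW hdW) x : HA L e dV hdV dW hdW))
        else 0 := ⟨_, fun _ _ _ _ => rfl⟩
  -- continuity of `a ↦ a · x` into `HA`
  have hcont_ax : ∀ x : UnitaryGroup.finAdelic (Fp L) L (IsCMField.complexConj L) (n + n) (hermD L e dV hdV dW hdW),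
      Continuous fun a : UnitaryGroup.arch (Fp L) L (IsCMField.complexConj L) (n + n) (hermD L e dV hdV dW hdW) =>
        ((UnitaryGroup.archToAdelic (Fp L) L (IsCMField.complexConj L) (n + n) (hermD L e dV hdV dW hdW) a *
          UnitaryGroup.finAdelicToAdelic (Fp L) L (IsCMField.complexConj L) (n + n) (hermD L e dV hdV dW hdW) x : HA L e dV hdV dW hdW)) :=
    fun x => (continuous_archEmb (Fp L) L (IsCMField.complexConj L) (n + n) (hermD L e dV hdV dW hdW)).mul continuous_const
  -- apply the abstract frame descent
  refine Exists.elim (exists_holDescend_of_frame k Fr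
    (frame_mul L e dV hdV dW hdW T Tinv Fr hFr hT2) (frame_mem L e dV hdV dW hdW T Tinv Fr hFr hTU)
    (frame_surj L e dV hdV dW hdW T Tinv Fr hFr hTS) hinj (frame_isInducing L e dV hdV dW hdW T Tinv Fr hFr hT2 hdV0 hdW0)
    (fun x a => F ((UnitaryGroup.archToAdelic (Fp L) L (IsCMField.complexConj L) (n + n) (hermD L e dV hdV dW hdW) a *
      UnitaryGroup.finAdelicToAdelic (Fp L) L (IsCMField.complexConj L) (n + n) (hermD L e dV hdV dW hdW) x : HA L e dV hdV dW hdW)))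
    Φ hΦ (fun x a u hu => hKtype x a u hu) E ?_ D ?_ ?_ ?_ ?_) (fun f hf => ⟨Φ, f, hΦ, hf.1, hf.2⟩)
  · -- (hE) the frame image of the one-parameter subgroup
    intro w Y t hY; rw [hEdef, dif_pos hY]
    exact frame_expGL L e dV hdV dW hdW T Tinv Fr hFr hT1 hT2 (hXl_mem w Y hY) w Y (hXl_w w Y hY) (hXl_0 w Y hY) t
  · -- (hDF) the derivative along `a · E w Y t`, from the G1 clause (products typed in the subgroup `adelic = HA` through ★ `archEmb`/`finEmb`)
    intro x w Y a hY
    rw [hDdef, dif_pos hY]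
    have hfun : (fun t : ℝ => F ((UnitaryGroup.archToAdelic (Fp L) L (IsCMField.complexConj L) (n + n) (hermD L e dV hdV dW hdW) (a * E w Y t) *
        UnitaryGroup.finAdelicToAdelic (Fp L) L (IsCMField.complexConj L) (n + n) (hermD L e dV hdV dW hdW) x : HA L e dV hdV dW hdW))) =
        fun t : ℝ => F ((archEmb (Fp L) L (IsCMField.complexConj L) (n + n) (hermD L e dV hdV dW hdW) a *
          finEmb (Fp L) L (IsCMField.complexConj L) (n + n) (hermD L e dV hdV dW hdW) x *
          archExp (Fp L) L (IsCMField.complexConj L) (n + n) (hermD L e dV hdV dW hdW) (hXl_mem w Y hY) t : HA L e dV hdV dW hdW)) := by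
      funext t
      rw [hEdef, dif_pos hY, map_mul, mul_assoc,
        (UnitaryGroup.commute_archToAdelic_finAdelicToAdelic (Fp L) L (IsCMField.complexConj L) (n + n) (hermD L e dV hdV dW hdW) _ x).eq,
        ← mul_assoc]
      rfl
    rw [hfun]
    have h := hL (Xl w Y hY) (hXl_mem w Y hY)
      (archEmb (Fp L) L (IsCMField.complexConj L) (n + n) (hermD L e dV hdV dW hdW) a *
        finEmb (Fp L) L (IsCMField.complexConj L) (n + n) (hermD L e dV hdV dW hdW) x) 0
    rwa [archExp_zero, mul_one] at h
  · -- (hDFl) linearity in `Y`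
    intro x w a c Y Y' hY hY'
    have hYY : (c • Y + Y')ᴴ * Matrix.J (Fin n) ℂ + Matrix.J (Fin n) ℂ * (c • Y + Y') = 0 := by
      rw [Matrix.conjTranspose_add, Matrix.conjTranspose_smul, star_trivial, Matrix.add_mul, Matrix.mul_add, Matrix.smul_mul,
        Matrix.mul_smul, add_add_add_comm, ← smul_add, hY, hY', smul_zero, add_zero]
    rw [hDdef, hDdef, hDdef, dif_pos hYY, dif_pos hY, dif_pos hY', hXl_lin w c Y Y' hY hY' hYY]
    exact hLl c _ _ (hXl_mem w Y hY) (hXl_mem w Y' hY') _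
  · -- (hDFc) continuity in `a`
    intro x w Y hY
    have hfun : D x w Y = fun a => DF (Xl w Y hY)
        ((UnitaryGroup.archToAdelic (Fp L) L (IsCMField.complexConj L) (n + n) (hermD L e dV hdV dW hdW) a *
          UnitaryGroup.finAdelicToAdelic (Fp L) L (IsCMField.complexConj L) (n + n) (hermD L e dV hdV dW hdW) x : HA L e dV hdV dW hdW)) := by
      funext a; rw [hDdef, dif_pos hY]
    rw [hfun]
    exact (hLc _ (hXl_mem w Y hY)).comp (hcont_ax x)
  · -- (hCR) the Cauchy–Riemann relation at the framed letters
    intro x w b a hb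
    have hμ := K2LiuHermitianTubeCRDeriv.levi_gen_mem (l := Fin n) hb
    have hσ := K2LiuHermitianTubeCRCartan.sigma_gen_mem (l := Fin n) hb
    rw [hDdef, hDdef, dif_pos hμ, dif_pos hσ]
    exact hCR x w b a _ _ hb (hXl_mem w _ hμ) (hXl_mem w _ hσ) (hXl_w w _ hμ) (hXl_0 w _ hμ) (hXl_w w _ hσ) (hXl_0 w _ hσ)

end Summit.HodgeConjecture.HodgeConjecture.Cruxes.HLiu418.K2LiuHolDescendAdelic

end
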